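import Summits.BirchSwinnertonDyer.BirchSwinnertonDyer.Theses.DefiniteGrossPeriodAtTwo

/-!
# LINE 11 glue: `OffDefiniteHabitatAtTwoOfAnchor` (item stmt-BirchSwinnertonDyer-27580)

Definite-anchored rank-one Heegner twists at 2: on the cell (W of analytic rank 1, W ≅ B^(d_K) for a
rank-0 definite anchor B and an admissible K with optimal odd-Manin frame and y_K of infinite order)
take M₀ and the depth-1 certificate from anchor primitivity (A1), exactness #Ш(B/K)[2^∞] = 2^(2M₀)
from the shared Kolyvagin exactness kernel at t = 0 (A2), BSD₂(B) from the route's own rank-0 output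
on H₃ (A4), and conclude BSD₂(W) by mirror exact descent (A3); off the cell the residual (A5) applies.
-/

namespace Summit.BirchSwinnertonDyer.BirchSwinnertonDyer.Theses.DefiniteGrossPeriodAtTwo

/-- LINE 11 glue (item stmt-BirchSwinnertonDyer-27580): the children A1 `AnchorPrimitivityAtTwo`,
A2 `KolyvaginExactAtTwoShifted` (GK2 J3, shared), A3 `MirrorExactDescentAtTwo`, A4 `DefiniteAnchorBSDTwo`
and the declared residual A5 `OffAnchoredTwistResidualAtTwo` imply the parent `OffDefiniteHabitatAtTwo`,
by a case split on the anchored-twist cell. Pure logic over the route's own statements; no crux,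
rung or summit is proved here. -/
theorem offDefiniteHabitatAtTwoOfAnchor_proof : OffDefiniteHabitatAtTwoOfAnchor := by
  unfold OffDefiniteHabitatAtTwoOfAnchor AnchorPrimitivityAtTwo KolyvaginExactAtTwoShifted MirrorExactDescentAtTwo DefiniteAnchorBSDTwo OffAnchoredTwistResidualAtTwo OffDefiniteHabitatAtTwo
  intro h1 h2 h3 h4 h5 W _ _ hcm hr hnH
  by_cases hC : (W.analyticRank = 1 ∧ ∃ (B : WeierstrassCurve ℚ) (_ : B.IsElliptic) (_ : B.IsGloballyMinimal) (_ : NeZero (B.conductorNorm ℤ)), ¬ B.HasCM ∧ B.analyticRank = 0 ∧ (B.HasSurjectiveModNGaloisRep (2 : ℤ) ∧ ¬ IsSquare (-(B.Δ)) ∧ Squarefree (B.conductorNorm ℤ) ∧ (∀ q ∈ (B.conductorNorm ℤ).primeFactors, Odd ((B.minimalDiscriminantNorm ℤ).factorization q)) ∧ (¬ 2 ∣ B.conductorNorm ℤ → ∃ v : IsDedekindDomain.HeightOneSpectrum (NumberField.RingOfIntegers ℚ), ((2 : ℕ) : NumberField.RingOfIntegers ℚ) ∈ v.asIdeal ∧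 ∃ 𝔓 ∈ v.primesAbove, ∃ σ ∈ 𝔓.decompositionSubgroup (Field.absoluteGaloisGroup ℚ), ∃ P : B.geomTorsion (2 : ℤ), σ • P ≠ P)) ∧ B.Δ < 0 ∧ ¬ 2 ∣ B.conductorNorm ℤ ∧ (∀ n : ℕ, 0 < n → B.HasSurjectiveModNGaloisRep ((2 : ℤ) ^ n)) ∧ Odd B.tamagawaProduct ∧ ∃ (K : Type) (_ : Field K) (_ : NumberField K), Literature.NumberTheory.EllipticCurves.IsImaginaryQuadratic K ∧ Odd (NumberField.discr K) ∧ NumberField.discr K ≠ -3 ∧ Literature.NumberTheory.EllipticCurves.SatisfiesHeegnerHypothesis (B.conductorNorm ℤ) K ∧ ¬ IsSquare ((NumberField.discr K : ℚ) * -|B.Δ|) ∧ ¬ IsSquare ((NumberField.discr K : ℚ) * (-(2 * |B.Δ|))) ∧ (∃ C : WeierstrassCurve.VariableChange ℚ, C • B.quadraticTwist (NumberField.discr K : ℚ) = W) ∧ ∃ (Dt : Literature.NumberTheory.EllipticCurves.ModularForms.ModularParametrizationData B (B.conductorNorm ℤ)) (β : ℤ) (ι : K →+* ℂ) (d₁ :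 Literature.NumberTheory.EllipticCurves.KolyvaginHeegnerData Dt β ι 1), (∀ z ∈ Dt.L.lattice, ∃ w ∈ Literature.NumberTheory.EllipticCurves.ModularForms.periodLattice Dt.f, z = (Dt.c : ℂ) * w) ∧ Odd Dt.c ∧ ¬ IsOfFinAddOrder d₁.derivedPoint)
  · obtain ⟨hr1, B, iB, mB, nzB, hcmB, hrB, hH3B, hΔ, hN2, hρ, hc, K, fK, nfK, hIQ, hodd, hd3, hHe, hsq1, hsq2, hCW, Dt, β, ι, d₁, hopt, hman, hy⟩ := hC
    obtain ⟨⟨M₀, hdiv, hndiv⟩, n, d, hn, hKoly, hPn⟩ := h1 B hcmB hrB hΔ hN2 hρ hc K hIQ hodd hd3 hHe hsq1 hsq2 Dt hopt hman β ι d₁ hy W hCW hr1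
    have hT : ∀ (s : ℕ), s ≤ 0 → ∀ (n : ℕ) (d : Literature.NumberTheory.EllipticCurves.KolyvaginHeegnerData Dt β ι n), Squarefree n → (∀ ℓ ∈ n.primeFactors, Literature.NumberTheory.EllipticCurves.Zhang2014.IsKolyvaginPrime (B.conductorNorm ℤ) B K 2 ℓ ∧ s ≤ Literature.NumberTheory.EllipticCurves.Zhang2014.kolyvaginIndex B 2 ℓ) → ∃ Q : (B.baseChange (Literature.NumberTheory.EllipticCurves.ringClassField K ι n)).toAffine.Point, ((2 ^ s : ℕ) : ℤ) • Q = d.derivedPoint := by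
      intro s hs n' d' _ _
      obtain rfl : s = 0 := Nat.le_zero.mp hs
      exact ⟨d'.derivedPoint, by simp⟩
    have hKoly' : ∀ ℓ ∈ n.primeFactors, Literature.NumberTheory.EllipticCurves.Zhang2014.IsKolyvaginPrime (B.conductorNorm ℤ) B K 2 ℓ ∧ 0 + 1 ≤ Literature.NumberTheory.EllipticCurves.Zhang2014.kolyvaginIndex B 2 ℓ :=
      fun ℓ hℓ => ⟨(hKoly ℓ hℓ).1, by simpa using (hKoly ℓ hℓ).2⟩
    have hPn' : ¬ ∃ Q : (B.baseChange (Literature.NumberTheory.EllipticCurves.ringClassField K ι n)).toAffine.Point, ((2 ^ (0 + 1) : ℕ) : ℤ) • Q = d.derivedPoint := by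
      simpa using hPn
    have hex := h2 B hcmB hΔ K hIQ hodd hd3 hHe hsq1 hsq2 hρ Dt β ι d₁ hy M₀ hdiv hndiv 0 hT n d hn hKoly' hPn'
    have hB : Literature.NumberTheory.EllipticCurves.BSDp B 2 := h4 B hcmB hrB hH3B
    exact h3 B hcmB hrB hc K hIQ hodd hd3 hHe Dt hopt hman β ι d₁ hy M₀ hdiv hndiv (by simpa only [Nat.sub_zero] using hex) hB W hCW hr1
  · exact h5 W hcm hr hnH hC

end Summit.BirchSwinnertonDyer.BirchSwinnertonDyer.Theses.DefiniteGrossPeriodAtTwo
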